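import Mathlib
import Literature.Analysis.Matrix.DetAddDiagonalMinors
import Literature.Computability.AlgebraicComplexity.PermanentIrreducible
import Summits.ValiantsHypothesis.ValiantsHypothesis.Theses.FreeFermionCLL

/-!
# Route `FreeFermionCLL` — `NoQuarticReadOnce`: reduction to the 1820 principal-minor equations

Item `stmt-ValiantsHypothesis-13563` (support).  `NoQuarticReadOnce` says that no kernel
`K ∈ ℂ^{16×16}` (indexed by the cells of the `4 × 4` board) has
`[deg 4] det(1 + diag(x) K) = c · per₄` with `c ≠ 0`.

This helper file proves the bookkeeping every attack on the item (proof or refutation) goes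
through:

* `det_one_add_diagonal_X_mul_map_C` — the principal-minor expansion
  `det(1 + diag(X) K) = Σ_S (∏_{e ∈ S} X_e) · C (det K_S)` over all subsets `S` of the index type
  (from `Literature.Analysis.Matrix.det_add_diagonal_eq_sum_minors`);
* `coeff_indicator_det_one_add_diagonal_X_mul` — the coefficient of the square-free monomial `x^S`
  is the principal minor `det K_S`;
* `noQuarticReadOnce_minor_eq` — under the hypothesis of the item, for every `4`-set `S` of cells,
  `det K_S = c · [S is the graph of a permutation]`, i.e. `det K_S = c` on the `24` transversals and
  `det K_S = 0` on the other `1796` four-sets;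
* `noQuarticReadOnce_of_minors` — conversely, the item follows from the purely matrix-theoretic
  statement that these `1820` equations force `c = 0`.
-/

set_option linter.dupNamespace false

namespace Summit.ValiantsHypothesis.ValiantsHypothesis.Theorems.FreeFermionCLL

open MvPolynomial Matrix Finset
open Literature.Computability.AlgebraicComplexity

section Expansion

variable {ι : Type*} [Fintype ι] [DecidableEq ι] {R : Type*} [CommRing R]

omit [Fintype ι] in
/-- The square-free exponent vector `𝟙_S = Σ_{e ∈ S} e_e` of a finite set of variables. -/
theorem indicator_finsupp_apply (S : Finset ι) (e : ι) :
    (∑ f ∈ S, Finsupp.single f 1 : ι →₀ ℕ) e = if e ∈ S then 1 else 0 := by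
  rw [Finset.sum_apply']
  simp only [Finsupp.single_apply]
  rw [Finset.sum_ite_eq' S e (fun _ => 1)]

omit [Fintype ι] in
/-- `S ↦ 𝟙_S` is injective. -/
theorem indicator_finsupp_injective :
    Function.Injective (fun S : Finset ι => (∑ f ∈ S, Finsupp.single f 1 : ι →₀ ℕ)) := by
  intro S T h
  ext e
  have h' := DFunLike.congr_fun h e
  simp only [indicator_finsupp_apply] at h'
  by_cases hS : e ∈ S <;> by_cases hT : e ∈ T <;> simp [hS, hT] at h' ⊢

omit [Fintype ι] [DecidableEq ι] in
/-- The degree of `𝟙_S` is `|S|`. -/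
theorem degree_indicator_finsupp (S : Finset ι) :
    (∑ f ∈ S, Finsupp.single f 1 : ι →₀ ℕ).degree = S.card := by
  rw [map_sum]
  simp only [Finsupp.degree_single, Finset.sum_const, smul_eq_mul, mul_one]

omit [Fintype ι] [DecidableEq ι] in
/-- `(∏_{e ∈ S} X_e) · C a` is the monomial `a · x^{𝟙_S}`. -/
theorem prod_X_mul_C_eq_monomial (S : Finset ι) (a : R) :
    (∏ e ∈ S, (X e : MvPolynomial ι R)) * C a = monomial (∑ f ∈ S, Finsupp.single f 1) a := by
  rw [mul_comm, monomial_sum_index]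
  rfl

/-- **Principal-minor expansion** of a read-once principal-minor polynomial:
`det(1 + diag(X) · K) = Σ_{S} (∏_{e ∈ S} X_e) · C (det K_S)`, the sum over all subsets `S` of the
index type (row-multilinearity; `Literature.Analysis.Matrix.det_add_diagonal_eq_sum_minors` with
`M = diag(X) K` and unit shifts). -/
theorem det_one_add_diagonal_X_mul_map_C (K : Matrix ι ι R) :
    (1 + diagonal (fun e : ι => (X e : MvPolynomial ι R)) *
        K.map (fun a : R => (C a : MvPolynomial ι R))).det =
      ∑ S : Finset ι, (∏ e ∈ S, (X e : MvPolynomial ι R)) *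
        C (K.submatrix ((↑) : S → ι) ((↑) : S → ι)).det := by
  set M : Matrix ι ι (MvPolynomial ι R) :=
    diagonal (fun e : ι => (X e : MvPolynomial ι R)) * K.map (fun a : R => (C a : MvPolynomial ι R))
    with hM
  have h1 : (1 : Matrix ι ι (MvPolynomial ι R)) + M = M + diagonal (fun _ => 1) := by
    rw [diagonal_one, add_comm]
  rw [h1, Literature.Analysis.Matrix.det_add_diagonal_eq_sum_minors]
  refine Finset.sum_congr rfl fun S _ => ?_
  rw [Finset.prod_const_one, one_mul]
  have h2 : M.submatrix ((↑) : S → ι) ((↑) : S → ι) =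
      diagonal (fun e : S => (X (e : ι) : MvPolynomial ι R)) *
        (C : R →+* MvPolynomial ι R).mapMatrix (K.submatrix ((↑) : S → ι) ((↑) : S → ι)) := by
    ext i j
    simp only [hM, submatrix_apply, diagonal_mul, RingHom.mapMatrix_apply, map_apply]
  rw [h2, det_mul, det_diagonal, ← RingHom.map_det, Finset.prod_coe_sort]

/-- The coefficient of the square-free monomial `x^S` in `det(1 + diag(X) · K)` is the principal
minor `det K_S`. -/
theorem coeff_indicator_det_one_add_diagonal_X_mul (K : Matrix ι ι R) (S : Finset ι) :
    coeff (∑ f ∈ S, Finsupp.single f 1)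
        (1 + diagonal (fun e : ι => (X e : MvPolynomial ι R)) *
          K.map (fun a : R => (C a : MvPolynomial ι R))).det =
      (K.submatrix ((↑) : S → ι) ((↑) : S → ι)).det := by
  rw [det_one_add_diagonal_X_mul_map_C, coeff_sum]
  simp only [prod_X_mul_C_eq_monomial, coeff_monomial]
  rw [Finset.sum_eq_single S]
  · rw [if_pos rfl]
  · intro T _ hTS
    rw [if_neg]
    exact fun h => hTS (indicator_finsupp_injective h)
  · intro h
    exact absurd (Finset.mem_univ S) h

end Expansion

section Quartic

/-- The set of cells `{(ρ i, i)}` of a permutation `ρ` — a transversal of the board. -/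
theorem permMonomial_eq_indicator {n : Type*} [Fintype n] [DecidableEq n] (ρ : Equiv.Perm n) :
    permMonomial ρ = ∑ f ∈ (Finset.univ.image fun i : n => (ρ i, i)), Finsupp.single f 1 := by
  rw [permMonomial, Finset.sum_image]
  intro i _ j _ h
  exact (Prod.mk.inj h).2

/-- **Reduction to minors.** If `[deg 4] det(1 + diag(x) K) = c · per₄`, then for every `4`-set
`S` of cells, `det K_S = c` when `S = {(ρ i, i)}` is the graph of a permutation `ρ` and
`det K_S = 0` otherwise. -/
theorem noQuarticReadOnce_minor_eq (K : Matrix (Fin 4 × Fin 4) (Fin 4 × Fin 4) ℂ) (c : ℂ)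
    (h : MvPolynomial.homogeneousComponent 4
        (1 + Matrix.diagonal (fun e : Fin 4 × Fin 4 => MvPolynomial.X e) *
          K.map (fun a : ℂ => (MvPolynomial.C a : MvPolynomial (Fin 4 × Fin 4) ℂ))).det =
      MvPolynomial.C c * perPoly (Fin 4) ℂ)
    (S : Finset (Fin 4 × Fin 4)) (hS : S.card = 4) :
    (K.submatrix ((↑) : S → Fin 4 × Fin 4) ((↑) : S → Fin 4 × Fin 4)).det =
      if ∃ ρ : Equiv.Perm (Fin 4), Finset.univ.image (fun i => (ρ i, i)) = S then c else 0 := by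
  have hc := congr_arg (coeff (∑ f ∈ S, Finsupp.single f 1)) h
  rw [coeff_homogeneousComponent, degree_indicator_finsupp, if_pos hS,
    coeff_indicator_det_one_add_diagonal_X_mul, coeff_C_mul, coeff_perPoly] at hc
  rw [hc]
  split_ifs with hρ
  · obtain ⟨ρ, hρ⟩ := hρ
    rw [Finset.sum_eq_single ρ]
    · rw [if_pos, mul_one]
      rw [permMonomial_eq_indicator, hρ]
    · intro π _ hπ
      rw [if_neg]
      intro hπ'
      apply hπ
      apply permMonomial_injective
      rw [hπ', permMonomial_eq_indicator, hρ]
    · intro h'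
      exact absurd (Finset.mem_univ ρ) h'
  · rw [Finset.sum_eq_zero, mul_zero]
    intro π _
    rw [if_neg]
    intro hπ
    apply hρ
    refine ⟨π, indicator_finsupp_injective ?_⟩
    change (∑ f ∈ Finset.univ.image (fun i => (π i, i)), Finsupp.single f 1 : _ →₀ ℕ) = _
    rw [← permMonomial_eq_indicator, hπ]

/-- **The item is a statement about `4 × 4` principal minors.** `NoQuarticReadOnce` follows from:
for every `K ∈ ℂ^{16×16}` and `c`, if `det K_S = c · [S is a transversal]` for all `4`-sets `S`
of cells, then `c = 0`. -/
theorem noQuarticReadOnce_of_minors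
    (H : ∀ (K : Matrix (Fin 4 × Fin 4) (Fin 4 × Fin 4) ℂ) (c : ℂ),
      (∀ S : Finset (Fin 4 × Fin 4), S.card = 4 →
        (K.submatrix ((↑) : S → Fin 4 × Fin 4) ((↑) : S → Fin 4 × Fin 4)).det =
          if ∃ ρ : Equiv.Perm (Fin 4), Finset.univ.image (fun i => (ρ i, i)) = S then c else 0) →
      c = 0) :
    Summit.ValiantsHypothesis.ValiantsHypothesis.Theses.FreeFermionCLL.NoQuarticReadOnce := by
  intro K c h
  exact H K c (fun S hS => noQuarticReadOnce_minor_eq K c h S hS)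

/-- **Converse bookkeeping.** If the `4 × 4` principal minors of `K` follow the transversal
pattern, `det K_S = c · [S is the graph of a permutation]` for every `4`-set `S` of cells, then
`[deg 4] det(1 + diag(x) K) = c · per₄`.  (So the item is *equivalent* to the matrix statement of
`noQuarticReadOnce_of_minors`; an explicit kernel with this minor pattern and `c ≠ 0` would refute
it.) -/
theorem homogeneousComponent_eq_of_minors (K : Matrix (Fin 4 × Fin 4) (Fin 4 × Fin 4) ℂ) (c : ℂ)
    (h : ∀ S : Finset (Fin 4 × Fin 4), S.card = 4 →
      (K.submatrix ((↑) : S → Fin 4 × Fin 4) ((↑) : S → Fin 4 × Fin 4)).det =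
        if ∃ ρ : Equiv.Perm (Fin 4), Finset.univ.image (fun i => (ρ i, i)) = S then c else 0) :
    MvPolynomial.homogeneousComponent 4
        (1 + Matrix.diagonal (fun e : Fin 4 × Fin 4 => MvPolynomial.X e) *
          K.map (fun a : ℂ => (MvPolynomial.C a : MvPolynomial (Fin 4 × Fin 4) ℂ))).det =
      MvPolynomial.C c * perPoly (Fin 4) ℂ := by
  -- the graph of a permutation has four cells
  have hcard : ∀ ρ : Equiv.Perm (Fin 4),
      (Finset.univ.image (fun i : Fin 4 => (ρ i, i))).card = 4 := by
    intro ρ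
    rw [Finset.card_image_of_injective _ (fun i j hij => (Prod.mk.inj hij).2)]
    simp
  ext m
  rw [coeff_homogeneousComponent, coeff_C_mul, coeff_perPoly, det_one_add_diagonal_X_mul_map_C,
    coeff_sum]
  simp only [prod_X_mul_C_eq_monomial, coeff_monomial]
  by_cases hm : ∃ S : Finset (Fin 4 × Fin 4), (∑ f ∈ S, Finsupp.single f 1 : _ →₀ ℕ) = m
  · obtain ⟨S, rfl⟩ := hm
    rw [degree_indicator_finsupp, Finset.sum_eq_single S, if_pos rfl]
    · by_cases hS : S.card = 4
      · rw [if_pos hS, h S hS]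
        split_ifs with hρ
        · obtain ⟨ρ, hρ⟩ := hρ
          rw [Finset.sum_eq_single ρ, if_pos, mul_one]
          · rw [permMonomial_eq_indicator, hρ]
          · intro π _ hπ
            rw [if_neg]
            intro hπ'
            apply hπ
            apply permMonomial_injective
            rw [hπ', permMonomial_eq_indicator, hρ]
          · intro h'
            exact absurd (Finset.mem_univ ρ) h'
        · rw [Finset.sum_eq_zero, mul_zero]
          intro π _
          rw [if_neg]
          intro hπ
          apply hρ
          refine ⟨π, indicator_finsupp_injective ?_⟩
          change (∑ f ∈ Finset.univ.image (fun i => (π i, i)), Finsupp.single f 1 : _ →₀ ℕ) = _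
          rw [← permMonomial_eq_indicator, hπ]
      · rw [if_neg hS, Finset.sum_eq_zero, mul_zero]
        intro π _
        rw [if_neg]
        intro hπ
        apply hS
        have hπS : Finset.univ.image (fun i => (π i, i)) = S := by
          apply indicator_finsupp_injective
          change (∑ f ∈ Finset.univ.image (fun i => (π i, i)), Finsupp.single f 1 : _ →₀ ℕ) = _
          rw [← permMonomial_eq_indicator, hπ]
        rw [← hπS, hcard]
    · intro T _ hTS
      rw [if_neg]
      exact fun h' => hTS (indicator_finsupp_injective h')
    · intro h'
      exact absurd (Finset.mem_univ S) h'
  · -- `m` is not square-free: both sides vanish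
    push Not at hm
    rw [Finset.sum_eq_zero fun T _ => if_neg (hm T), Finset.sum_eq_zero, mul_zero, ite_self]
    intro π _
    rw [if_neg]
    intro hπ
    exact hm _ (by rw [← permMonomial_eq_indicator, hπ])

end Quartic

end Summit.ValiantsHypothesis.ValiantsHypothesis.Theorems.FreeFermionCLL
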